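import Literature.NumberTheory.Automorphic.ModularFunctionOrbitPolynomial
import Literature.NumberTheory.Automorphic.ModularLambdaWeightZero
import HarnessLib

/-!
# Modular forms of finite-index level are algebraic functions of `λ`

Tenth file on the modular `λ`-function. Calegari–Dimitrov–Tang (F. Calegari, V. Dimitrov,
Y. Tang, *The unbounded denominators conjecture*, J. Amer. Math. Soc. **38** (2025),
arXiv:2109.09040), §1 p. 3: "On replacing the weight `k` form `f` by [a] weight zero form … we may
(and do) assume that `k = 0`. The function `f` is then an algebraic function of `λ`, with branching
only at the three punctures `λ = 0, 1, ∞` of the modular curve `Y(2) ≅ ℙ¹ ∖ {0, 1, ∞}`." Here this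
sentence is PROVED for Mathlib's `ModularForm Γ k`, `Γ ≤ SL(2, ℤ)` of finite index, from the
analytic theorem `exists_polynomial_relation_of_invariant` of `ModularLambdaAlgebraic.lean`
(norm over the cosets of `Γ ∩ Γ(2)` in `Γ(2)`, Hauptmodul property of `λ`):

* **`exists_monic_polynomial_relation_of_weight_zero`** — a weight-`0` modular form `f` (holomorphic
  on `ℍ` and at the cusps) for a finite-index `Γ ≤ SL(2, ℤ)` is INTEGRAL over `ℂ[λ]`:
  `fᵈ + A_{d-1}(λ) f^{d-1} + ⋯ + A_0(λ) = 0` on `ℍ` with `A_n ∈ ℂ[X]`, `d ≥ 1`;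
* **`exists_polynomial_relation_modularForm`** — for a modular form `f` of even weight `2k` for a
  finite-index `Γ ≤ SL(2, ℤ)`, the weight-zero quotient `f/θ₃^{4k}` (`θ₃⁴ = U` is a weight-`2`
  form for `Γ(2)` without zeros on `ℍ`) is ALGEBRAIC over `ℂ(λ)`:
  `Σ_{n ≤ d} A_n(λ) (f/θ₃^{4k})ⁿ = 0` with `A_d = (λ(1−λ))^{kd} ≠ 0`;
  `exists_polynomial_relation_modularForm'` is the same identity with denominators cleared,
  `Σ_{n ≤ d} A_n(λ) θ₃^{4k(d−n)} fⁿ = 0`;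
* **`exists_polynomial_modularForm_Gamma_two`**, **`finiteDimensional_modularForm_Gamma_two`** —
  for `f ∈ M_{2k}(Γ(2))`: `(f/θ₃^{4k}) λᵏ(1−λ)ᵏ = P(λ)` with `deg P ≤ 3k`, so `M_{2k}(Γ(2))` is
  finite-dimensional of dimension `≤ 3k + 1` (the general Sturm-bound route:
  `Literature/NumberTheory/EllipticCurves/ModularCurveSturmWidthProofs.lean`; the sharp `k + 1`:
  `GammaTwoModularFormsBasis.lean`).

(CDT reduce the weight with the unit `λ/16η(τ/2)²`-type factors of `η`; any nowhere-vanishing form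
of weight `2` on `Γ(2)` does the same job for even weights, and we use `U = θ₃⁴`, already in the
tree.) The inputs about `U = θ₃⁴, V = θ₂⁴, W = θ₄⁴` (Cohn–Kumar–Miller–Radchenko–Viazovska,
arXiv:1902.05438, §2.1, tree file `Literature/NumberTheory/ModularForms/JacobiThetaGammaTwo.lean`:
`U|₂T = W, V|₂T = −V, W|₂T = U, U|₂S = −U, V|₂S = −W, W|₂S = −V`) give:

* (`thetaU_slash_of_mem_Gamma_two`, tree file `ModularLambdaWeightZero.lean`) — `U|₂γ = U` for
  `γ ∈ Γ(2)`;
* `slash_mem_six` / `thetaU_slash_mem_six` — `SL(2, ℤ) = ⟨S, T⟩` permutes the six functions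
  `±U, ±V, ±W` under `|₂`; in particular `U|₂g ∈ {±U, ±V, ±W}` for every `g ∈ SL(2, ℤ)`;
* `exists_lower_bound_of_mem_six` / `exists_lower_bound_thetaU_slash` — each of them is
  `≥ c·e^{−π Im z}` for `Im z` large (`U, W → 1`, `e^{−πiz} V → 16`), which is the growth
  hypothesis of `exists_polynomial_relation_of_invariant` for `f/U^k` at every cusp.

## References

* [CalegariDimitrovTang2025] F. Calegari, V. Dimitrov, Y. Tang, J. Amer. Math. Soc. 38 (2025),
  arXiv:2109.09040, §1 p. 3 ("`f` is then an algebraic function of `λ`"), §3 Prop. 15.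
* H. Cohn, A. Kumar, S. D. Miller, D. Radchenko, M. Viazovska, Ann. of Math. 196 (2022),
  arXiv:1902.05438, §2.1 (the forms `U, V, W` for `Γ(2)`).
-/

noncomputable section

open Complex Filter Topology Function Set Polynomial
open UpperHalfPlane hiding I
open scoped Real Topology MatrixGroups ModularForm Manifold

namespace Literature.NumberTheory.Automorphic

namespace ModularLambda

open Literature.NumberTheory.EllipticCurves.JacobiThetaNull
open Literature.NumberTheory.ModularForms (thetaU thetaV thetaW thetaU_apply thetaU_slash_T
  thetaV_slash_T thetaW_slash_T thetaU_slash_S thetaV_slash_S thetaW_slash_S tendsto_thetaU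
  tendsto_thetaW tendsto_exp_mul_thetaV)
open ModularGroup Matrix.SpecialLinearGroup

/-! ### `U = θ₃⁴` is a weight-`2` modular form for `Γ(2)` -/

/-- From `Y|₂g = X` we get `X|₂g⁻¹ = Y`. [folklore] -/
private theorem slash_inv_eq_of_slash_eq {X Y : ℍ → ℂ} {g : SL(2, ℤ)}
    (h : Y ∣[(2 : ℤ)] g = X) : X ∣[(2 : ℤ)] g⁻¹ = Y := by
  rw [← h, ← SlashAction.slash_mul, mul_inv_cancel, SlashAction.slash_one]

/-- From `Y|₂g = -X` we get `X|₂g⁻¹ = -Y`. [folklore] -/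
private theorem slash_inv_eq_neg_of_slash_eq {X Y : ℍ → ℂ} {g : SL(2, ℤ)}
    (h : Y ∣[(2 : ℤ)] g = -X) : X ∣[(2 : ℤ)] g⁻¹ = -Y :=
  slash_inv_eq_of_slash_eq (by rw [SlashAction.neg_slash, h, neg_neg])

/-- `V|₂S⁻¹ = −W`. [folklore] -/
theorem thetaV_slash_S_inv : thetaV ∣[(2 : ℤ)] ModularGroup.S⁻¹ = -thetaW :=
  slash_inv_eq_neg_of_slash_eq thetaW_slash_S

/-- `W|₂S⁻¹ = −V`. [folklore] -/
theorem thetaW_slash_S_inv : thetaW ∣[(2 : ℤ)] ModularGroup.S⁻¹ = -thetaV :=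
  slash_inv_eq_neg_of_slash_eq thetaV_slash_S

/-- `U|₂T⁻¹ = W`. [folklore] -/
theorem thetaU_slash_T_inv : thetaU ∣[(2 : ℤ)] ModularGroup.T⁻¹ = thetaW :=
  slash_inv_eq_of_slash_eq thetaW_slash_T

/-- `W|₂T⁻¹ = U`. [folklore] -/
theorem thetaW_slash_T_inv : thetaW ∣[(2 : ℤ)] ModularGroup.T⁻¹ = thetaU :=
  slash_inv_eq_of_slash_eq thetaU_slash_T

/-- `V|₂T⁻¹ = −V`. [folklore] -/
theorem thetaV_slash_T_inv : thetaV ∣[(2 : ℤ)] ModularGroup.T⁻¹ = -thetaV :=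
  slash_inv_eq_neg_of_slash_eq thetaV_slash_T

/-- `S² = −1` in `SL(2, ℤ)`. [folklore] -/
theorem S_mul_S : ModularGroup.S * ModularGroup.S = (-1 : SL(2, ℤ)) :=
  Subtype.ext (by
    rw [Matrix.SpecialLinearGroup.coe_mul, Matrix.SpecialLinearGroup.coe_neg,
      Matrix.SpecialLinearGroup.coe_one]
    exact ModularGroup.S_mul_S_eq)

/- `U ∣₂ γ = U` and `U(γ • z) = (cz + d)² U(z)` for `γ ∈ Γ(2)` are
`thetaU_slash_of_mem_Gamma_two` / `thetaU_smul_of_mem_Gamma_two` of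
`Literature/NumberTheory/Automorphic/ModularLambdaWeightZero.lean`. -/

/-! ### `SL(2, ℤ)` permutes `±U, ±V, ±W` -/

/-- `S` maps the six functions `±U, ±V, ±W` into themselves under `|₂`. [folklore] -/
private theorem slash_S_mem_six {X : ℍ → ℂ}
    (hX : X ∈ ({thetaU, -thetaU, thetaV, -thetaV, thetaW, -thetaW} : Set (ℍ → ℂ))) :
    X ∣[(2 : ℤ)] ModularGroup.S ∈
      ({thetaU, -thetaU, thetaV, -thetaV, thetaW, -thetaW} : Set (ℍ → ℂ)) := by
  simp only [Set.mem_insert_iff, Set.mem_singleton_iff] at hX ⊢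
  rcases hX with rfl | rfl | rfl | rfl | rfl | rfl
  · rw [thetaU_slash_S]; simp
  · rw [SlashAction.neg_slash, thetaU_slash_S, neg_neg]; simp
  · rw [thetaV_slash_S]; simp
  · rw [SlashAction.neg_slash, thetaV_slash_S, neg_neg]; simp
  · rw [thetaW_slash_S]; simp
  · rw [SlashAction.neg_slash, thetaW_slash_S, neg_neg]; simp

/-- `S⁻¹` maps the six functions `±U, ±V, ±W` into themselves under `|₂`. [folklore] -/
private theorem slash_S_inv_mem_six {X : ℍ → ℂ}
    (hX : X ∈ ({thetaU, -thetaU, thetaV, -thetaV, thetaW, -thetaW} : Set (ℍ → ℂ))) :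
    X ∣[(2 : ℤ)] ModularGroup.S⁻¹ ∈
      ({thetaU, -thetaU, thetaV, -thetaV, thetaW, -thetaW} : Set (ℍ → ℂ)) := by
  simp only [Set.mem_insert_iff, Set.mem_singleton_iff] at hX ⊢
  rcases hX with rfl | rfl | rfl | rfl | rfl | rfl
  · rw [thetaU_slash_S_inv]; simp
  · rw [SlashAction.neg_slash, thetaU_slash_S_inv, neg_neg]; simp
  · rw [thetaV_slash_S_inv]; simp
  · rw [SlashAction.neg_slash, thetaV_slash_S_inv, neg_neg]; simp
  · rw [thetaW_slash_S_inv]; simp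
  · rw [SlashAction.neg_slash, thetaW_slash_S_inv, neg_neg]; simp

/-- `T` maps the six functions `±U, ±V, ±W` into themselves under `|₂`. [folklore] -/
private theorem slash_T_mem_six {X : ℍ → ℂ}
    (hX : X ∈ ({thetaU, -thetaU, thetaV, -thetaV, thetaW, -thetaW} : Set (ℍ → ℂ))) :
    X ∣[(2 : ℤ)] ModularGroup.T ∈
      ({thetaU, -thetaU, thetaV, -thetaV, thetaW, -thetaW} : Set (ℍ → ℂ)) := by
  simp only [Set.mem_insert_iff, Set.mem_singleton_iff] at hX ⊢
  rcases hX with rfl | rfl | rfl | rfl | rfl | rfl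
  · rw [thetaU_slash_T]; simp
  · rw [SlashAction.neg_slash, thetaU_slash_T]; simp
  · rw [thetaV_slash_T]; simp
  · rw [SlashAction.neg_slash, thetaV_slash_T, neg_neg]; simp
  · rw [thetaW_slash_T]; simp
  · rw [SlashAction.neg_slash, thetaW_slash_T]; simp

/-- `T⁻¹` maps the six functions `±U, ±V, ±W` into themselves under `|₂`. [folklore] -/
private theorem slash_T_inv_mem_six {X : ℍ → ℂ}
    (hX : X ∈ ({thetaU, -thetaU, thetaV, -thetaV, thetaW, -thetaW} : Set (ℍ → ℂ))) :
    X ∣[(2 : ℤ)] ModularGroup.T⁻¹ ∈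
      ({thetaU, -thetaU, thetaV, -thetaV, thetaW, -thetaW} : Set (ℍ → ℂ)) := by
  simp only [Set.mem_insert_iff, Set.mem_singleton_iff] at hX ⊢
  rcases hX with rfl | rfl | rfl | rfl | rfl | rfl
  · rw [thetaU_slash_T_inv]; simp
  · rw [SlashAction.neg_slash, thetaU_slash_T_inv]; simp
  · rw [thetaV_slash_T_inv]; simp
  · rw [SlashAction.neg_slash, thetaV_slash_T_inv, neg_neg]; simp
  · rw [thetaW_slash_T_inv]; simp
  · rw [SlashAction.neg_slash, thetaW_slash_T_inv]; simp

/-- **`SL(2, ℤ)` permutes `±U, ±V, ±W` in weight `2`** (`SL(2, ℤ) = ⟨S, T⟩` and the `S, T`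
table of Cohn–Kumar–Miller–Radchenko–Viazovska §2.1). [folklore] -/
theorem slash_mem_six (g : SL(2, ℤ)) :
    ∀ X ∈ ({thetaU, -thetaU, thetaV, -thetaV, thetaW, -thetaW} : Set (ℍ → ℂ)),
      X ∣[(2 : ℤ)] g ∈ ({thetaU, -thetaU, thetaV, -thetaV, thetaW, -thetaW} : Set (ℍ → ℂ)) := by
  have hg : g ∈ Subgroup.closure ({ModularGroup.S, ModularGroup.T} : Set SL(2, ℤ)) := by
    rw [SpecialLinearGroup.SL2Z_generators]
    exact Subgroup.mem_top g
  induction hg using Subgroup.closure_induction'' with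
  | mem x hx =>
    intro X hX
    rcases hx with rfl | rfl
    exacts [slash_S_mem_six hX, slash_T_mem_six hX]
  | inv_mem x hx =>
    intro X hX
    rcases hx with rfl | rfl
    exacts [slash_S_inv_mem_six hX, slash_T_inv_mem_six hX]
  | one =>
    intro X hX
    rwa [SlashAction.slash_one]
  | mul x y _ _ hx hy =>
    intro X hX
    rw [SlashAction.slash_mul]
    exact hy _ (hx X hX)

/-- `U|₂g ∈ {±U, ±V, ±W}` for every `g ∈ SL(2, ℤ)`. [folklore] -/
theorem thetaU_slash_mem_six (g : SL(2, ℤ)) :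
    thetaU ∣[(2 : ℤ)] g ∈ ({thetaU, -thetaU, thetaV, -thetaV, thetaW, -thetaW} : Set (ℍ → ℂ)) :=
  slash_mem_six g thetaU (by simp)

/-! ### Lower bounds at `i∞` -/

/-- `‖e^{−πiz}‖ = e^{π Im z}`. [folklore] -/
private theorem norm_exp_neg_pi_I_mul (z : ℍ) :
    ‖cexp (-(π * Complex.I * (z : ℂ)))‖ = Real.exp (π * z.im) := by
  rw [Complex.norm_exp]
  congr 1
  simp [Complex.mul_re, Complex.mul_im, UpperHalfPlane.coe_im]

/-- Each of `U, V, W` is bounded below by `c e^{−π Im z}` for `Im z` large: `U, W → 1` and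
`e^{−πiz} V(z) → 16` as `Im z → ∞`. [folklore] -/
private theorem exists_lower_bound_UVW {Y : ℍ → ℂ} (hY : Y = thetaU ∨ Y = thetaV ∨ Y = thetaW) :
    ∃ B c : ℝ, 0 < c ∧ ∀ z : ℍ, B ≤ z.im → c * Real.exp (-(π * z.im)) ≤ ‖Y z‖ := by
  have hexp : ∀ z : ℍ, Real.exp (-(π * z.im)) ≤ 1 := fun z ↦
    Real.exp_le_one_iff.mpr (neg_nonpos.mpr (by positivity))
  -- the two functions tending to `1`
  have hone : ∀ {Z : ℍ → ℂ}, Tendsto Z atImInfty (𝓝 1) →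
      ∃ B c : ℝ, 0 < c ∧ ∀ z : ℍ, B ≤ z.im → c * Real.exp (-(π * z.im)) ≤ ‖Z z‖ := by
    intro Z hZ
    obtain ⟨B, hB⟩ := (atImInfty_mem _).mp (hZ (Metric.ball_mem_nhds (1 : ℂ) one_half_pos))
    refine ⟨B, 1 / 2, one_half_pos, fun z hz ↦ ?_⟩
    have h : dist (Z z) 1 < 1 / 2 := hB z hz
    rw [dist_eq_norm] at h
    have h1 : (1 : ℝ) - ‖Z z‖ ≤ ‖Z z - 1‖ := by
      have := norm_sub_norm_le (1 : ℂ) (Z z)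
      rwa [norm_one, norm_sub_rev] at this
    calc 1 / 2 * Real.exp (-(π * z.im)) ≤ 1 / 2 * 1 := by gcongr; exact hexp z
      _ ≤ ‖Z z‖ := by linarith
  rcases hY with rfl | rfl | rfl
  · exact hone tendsto_thetaU
  · -- `V`: `‖e^{-πiz} V(z) - 16‖ < 8` eventually
    obtain ⟨B, hB⟩ := (atImInfty_mem _).mp
      (tendsto_exp_mul_thetaV (Metric.ball_mem_nhds (16 : ℂ) (by norm_num : (0 : ℝ) < 8)))
    refine ⟨B, 8, by norm_num, fun z hz ↦ ?_⟩
    have h : dist (cexp (-(π * Complex.I * (z : ℂ))) * thetaV z) 16 < 8 := hB z hz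
    rw [dist_eq_norm] at h
    have h1 : (16 : ℝ) - ‖cexp (-(π * Complex.I * (z : ℂ))) * thetaV z‖ ≤
        ‖cexp (-(π * Complex.I * (z : ℂ))) * thetaV z - 16‖ := by
      have := norm_sub_norm_le (16 : ℂ) (cexp (-(π * Complex.I * (z : ℂ))) * thetaV z)
      have h16 : ‖(16 : ℂ)‖ = 16 := by simp
      rwa [h16, norm_sub_rev] at this
    rw [norm_mul, norm_exp_neg_pi_I_mul] at h1
    have hpos : 0 < Real.exp (π * z.im) := Real.exp_pos _
    have hinv : Real.exp (-(π * z.im)) = (Real.exp (π * z.im))⁻¹ := Real.exp_neg _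
    rw [hinv, ← div_eq_mul_inv, div_le_iff₀ hpos, mul_comm]
    linarith
  · exact hone tendsto_thetaW

/-- **Each of `±U, ±V, ±W` is `≥ c e^{−π Im z}` for `Im z` large.** [folklore] -/
theorem exists_lower_bound_of_mem_six {X : ℍ → ℂ}
    (hX : X ∈ ({thetaU, -thetaU, thetaV, -thetaV, thetaW, -thetaW} : Set (ℍ → ℂ))) :
    ∃ B c : ℝ, 0 < c ∧ ∀ z : ℍ, B ≤ z.im → c * Real.exp (-(π * z.im)) ≤ ‖X z‖ := by
  simp only [Set.mem_insert_iff, Set.mem_singleton_iff] at hX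
  have hneg : ∀ {Y : ℍ → ℂ}, (Y = thetaU ∨ Y = thetaV ∨ Y = thetaW) →
      ∃ B c : ℝ, 0 < c ∧ ∀ z : ℍ, B ≤ z.im → c * Real.exp (-(π * z.im)) ≤ ‖(-Y) z‖ := by
    intro Y hY
    obtain ⟨B, c, hc, h⟩ := exists_lower_bound_UVW hY
    exact ⟨B, c, hc, fun z hz ↦ by rw [Pi.neg_apply, norm_neg]; exact h z hz⟩
  rcases hX with rfl | rfl | rfl | rfl | rfl | rfl
  exacts [exists_lower_bound_UVW (Or.inl rfl), hneg (Or.inl rfl),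
    exists_lower_bound_UVW (Or.inr (Or.inl rfl)), hneg (Or.inr (Or.inl rfl)),
    exists_lower_bound_UVW (Or.inr (Or.inr rfl)), hneg (Or.inr (Or.inr rfl))]

/-- **`‖(U|₂g)(z)‖ ≥ c e^{−π Im z}` for `Im z` large**, for every `g ∈ SL(2, ℤ)`: the weight-`2`
form `U` has at worst a simple zero in `q = e^{2πiτ}`... more precisely order `≤ 1/2`, at every
cusp. [folklore] -/
theorem exists_lower_bound_thetaU_slash (g : SL(2, ℤ)) :
    ∃ B c : ℝ, 0 < c ∧ ∀ z : ℍ, B ≤ z.im →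
      c * Real.exp (-(π * z.im)) ≤ ‖(thetaU ∣[(2 : ℤ)] g) z‖ :=
  exists_lower_bound_of_mem_six (thetaU_slash_mem_six g)

/-! ### The theorems -/

/-- **Weight-`0` modular forms of finite-index level are integral over `ℂ[λ]`.** For
`Γ ≤ SL(2, ℤ)` of finite index and `f ∈ M₀(Γ)` (holomorphic on `ℍ`, `Γ`-invariant, bounded at
all cusps) there are `d ≥ 1` and `A_0, …, A_d ∈ ℂ[X]` with `A_d = 1` and
`Σ_{n ≤ d} A_n(λ(τ)) f(τ)ⁿ = 0` on `ℍ`. (`exists_polynomial_relation_of_invariant` with `k = 0`: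
`f ∘ g` is bounded at `i∞` for every `g ∈ SL(2, ℤ)`.)
[cite: CalegariDimitrovTang2025, §1 p. 3 ("`f` is then an algebraic function of `λ`")] -/
theorem exists_monic_polynomial_relation_of_weight_zero {Γ : Subgroup SL(2, ℤ)} [Γ.FiniteIndex]
    (f : ModularForm (Γ : Subgroup (GL (Fin 2) ℝ)) 0) :
    ∃ (d : ℕ) (A : ℕ → ℂ[X]), 0 < d ∧ A d = 1 ∧
      ∀ τ : ℍ, ∑ n ∈ Finset.range (d + 1), (A n).eval (modularLambda τ) * f τ ^ n = 0 := by
  set F : ℂ → ℂ := ⇑f ∘ ofComplex with hF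
  have hFd : DifferentiableOn ℂ F {z : ℂ | 0 < z.im} :=
    UpperHalfPlane.mdifferentiable_iff.mp (ModularFormClass.holo f)
  have hinv : ∀ γ ∈ Γ, ∀ z : ℍ, F ((γ • z : ℍ) : ℂ) = F z := by
    intro γ hγ z
    simp only [hF, comp_apply, ofComplex_apply]
    rw [SlashInvariantForm.slash_action_eqn_SL'' f hγ z, zpow_zero, one_mul]
  have hgr : ∀ g : SL(2, ℤ), ∃ B M : ℝ, ∀ z : ℍ, B ≤ z.im →
      ‖F ((g • z : ℍ) : ℂ)‖ ≤ M * Real.exp (π * (0 : ℕ) * z.im) := by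
    intro g
    obtain ⟨M, B, hMB⟩ := isBoundedAtImInfty_iff.mp (ModularFormClass.bdd_at_infty_slash f g)
    refine ⟨B, M, fun z hz ↦ ?_⟩
    have h := hMB z hz
    rw [ModularForm.SL_slash_apply, neg_zero, zpow_zero, mul_one] at h
    simp only [hF, comp_apply, ofComplex_apply, Nat.cast_zero, mul_zero, zero_mul, Real.exp_zero,
      mul_one]
    exact h
  obtain ⟨d, A, hd, hAd, hrel⟩ := exists_polynomial_relation_of_invariant (Γ := Γ) 0 hFd hinv hgr
  refine ⟨d, A, hd, by rw [hAd, zero_mul, pow_zero], fun τ ↦ ?_⟩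
  have := hrel τ τ.im_pos
  simpa only [hF, comp_apply, ofComplex_apply] using this

/-- The weight-zero quotient `F = f/θ₃^{4k}` of a modular form of weight `2k`, as a function on
`ℂ` (extended by Mathlib's `ofComplex` off `ℍ`), is holomorphic on `ℍ`. [folklore] -/
theorem differentiableOn_modularForm_div {Γ : Subgroup SL(2, ℤ)} [Γ.FiniteIndex] (k : ℕ)
    (f : ModularForm (Γ : Subgroup (GL (Fin 2) ℝ)) (2 * k : ℤ)) :
    DifferentiableOn ℂ (fun z ↦ f (ofComplex z) / theta3 z ^ (4 * k)) {z : ℂ | 0 < z.im} := by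
  have h1 : DifferentiableOn ℂ (⇑f ∘ ofComplex) {z : ℂ | 0 < z.im} :=
    UpperHalfPlane.mdifferentiable_iff.mp (ModularFormClass.holo f)
  refine h1.div (fun z hz ↦ ?_) fun z hz ↦ pow_ne_zero _ (theta3_ne_zero hz)
  exact ((differentiableAt_theta3 hz).pow _).differentiableWithinAt

/-- `F = f/θ₃^{4k} = f/Uᵏ` is invariant under `Γ ∩ Γ(2)` (`U|₂γ = U` on `Γ(2)`).
[cite: CalegariDimitrovTang2025, §1 p. 3] -/
theorem modularForm_div_smul {Γ : Subgroup SL(2, ℤ)} [Γ.FiniteIndex] (k : ℕ)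
    (f : ModularForm (Γ : Subgroup (GL (Fin 2) ℝ)) (2 * k : ℤ)) {γ : SL(2, ℤ)} (hγ1 : γ ∈ Γ)
    (hγ2 : γ ∈ CongruenceSubgroup.Gamma 2) (z : ℍ) :
    f (γ • z) / theta3 ((γ • z : ℍ) : ℂ) ^ (4 * k) = f z / theta3 z ^ (4 * k) := by
  have hU : ∀ w : ℍ, theta3 (w : ℂ) ^ (4 * k) = thetaU w ^ k := fun w ↦ by
    rw [pow_mul, thetaU_apply]
  have hD : denom (γ : GL (Fin 2) ℝ) z ^ (2 : ℤ) ≠ 0 := zpow_ne_zero _ (denom_ne_zero _ z)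
  rw [hU, hU, SlashInvariantForm.slash_action_eqn_SL'' f hγ1 z,
    thetaU_smul_of_mem_Gamma_two hγ2 z, mul_pow, zpow_mul, zpow_natCast,
    mul_div_mul_left _ _ (pow_ne_zero _ hD)]

/-- `F(g • z) = (f|g)(z)/((U|₂g)(z))ᵏ` for `F = f/θ₃^{4k}` and `g ∈ SL(2, ℤ)` (the automorphy
factors cancel). [folklore] -/
theorem modularForm_div_smul_eq_slash {Γ : Subgroup SL(2, ℤ)} [Γ.FiniteIndex] (k : ℕ)
    (f : ModularForm (Γ : Subgroup (GL (Fin 2) ℝ)) (2 * k : ℤ)) (g : SL(2, ℤ)) (z : ℍ) :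
    f (g • z) / theta3 ((g • z : ℍ) : ℂ) ^ (4 * k) =
      (⇑f ∣[(2 * k : ℤ)] g) z / ((thetaU ∣[(2 : ℤ)] g) z) ^ k := by
  have hD : denom (g : GL (Fin 2) ℝ) z ≠ 0 := denom_ne_zero _ z
  rw [pow_mul, ← thetaU_apply, ModularForm.SL_slash_apply, ModularForm.SL_slash_apply, mul_pow,
    ← zpow_natCast (denom (g : GL (Fin 2) ℝ) z ^ (-2 : ℤ)) k, ← zpow_mul, neg_mul,
    mul_div_mul_right _ _ (zpow_ne_zero _ hD)]

/-- **Growth of `F = f/θ₃^{4k}` at every cusp**: `|F(g • z)| ≤ M e^{πk Im z}` high up, for every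
`g ∈ SL(2, ℤ)` — `|F(g • z)| = |(f|g)(z)|/|(U|₂g)(z)|ᵏ` with `f|g` bounded and
`U|₂g ∈ {±U, ±V, ±W}` bounded below by `c e^{−π Im z}`. [cite: CalegariDimitrovTang2025, §1 p. 3] -/
theorem exists_norm_modularForm_div_smul_le {Γ : Subgroup SL(2, ℤ)} [Γ.FiniteIndex] (k : ℕ)
    (f : ModularForm (Γ : Subgroup (GL (Fin 2) ℝ)) (2 * k : ℤ)) (g : SL(2, ℤ)) :
    ∃ B M : ℝ, ∀ z : ℍ, B ≤ z.im →
      ‖f (g • z) / theta3 ((g • z : ℍ) : ℂ) ^ (4 * k)‖ ≤ M * Real.exp (π * k * z.im) := by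
  obtain ⟨M, A, hMA⟩ := isBoundedAtImInfty_iff.mp (ModularFormClass.bdd_at_infty_slash f g)
  obtain ⟨B, c, hc, hBc⟩ := exists_lower_bound_thetaU_slash g
  refine ⟨max A B, max M 0 / c ^ k, fun z hz ↦ ?_⟩
  have hA : ‖(⇑f ∣[(2 * k : ℤ)] g) z‖ ≤ max M 0 :=
    (hMA z ((le_max_left _ _).trans hz)).trans (le_max_left _ _)
  have hB := hBc z ((le_max_right _ _).trans hz)
  have hFg := modularForm_div_smul_eq_slash k f g z
  have hUpos : 0 < ‖(thetaU ∣[(2 : ℤ)] g) z‖ := lt_of_lt_of_le (by positivity) hB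
  rw [hFg, norm_div, norm_pow, div_le_iff₀ (pow_pos hUpos k)]
  have h1 : (c * Real.exp (-(π * z.im))) ^ k ≤ ‖(thetaU ∣[(2 : ℤ)] g) z‖ ^ k :=
    pow_le_pow_left₀ (by positivity) hB k
  have hck : c ^ k ≠ 0 := pow_ne_zero _ hc.ne'
  have hee : Real.exp (π * k * z.im) * Real.exp (-(π * z.im)) ^ k = 1 := by
    rw [← Real.exp_nat_mul, ← Real.exp_add]
    convert Real.exp_zero using 2
    ring
  have hM0 : 0 ≤ max M 0 := le_max_right _ _
  calc ‖(⇑f ∣[(2 * k : ℤ)] g) z‖ ≤ max M 0 := hA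
    _ = max M 0 / c ^ k * Real.exp (π * k * z.im) * (c * Real.exp (-(π * z.im))) ^ k := by
      rw [mul_pow, show max M 0 / c ^ k * Real.exp (π * k * z.im) *
          (c ^ k * Real.exp (-(π * z.im)) ^ k) = max M 0 *
          (Real.exp (π * k * z.im) * Real.exp (-(π * z.im)) ^ k) * (c ^ k / c ^ k) by ring,
        hee, div_self hck, mul_one, mul_one]
    _ ≤ max M 0 / c ^ k * Real.exp (π * k * z.im) * ‖(thetaU ∣[(2 : ℤ)] g) z‖ ^ k :=
      mul_le_mul_of_nonneg_left h1 (by positivity)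

/-- **Modular forms of finite-index level are algebraic functions of `λ`.** For `Γ ≤ SL(2, ℤ)` of
finite index and a modular form `f` of even weight `2k` for `Γ`, the weight-zero function
`f/θ₃^{4k} = f/Uᵏ` is algebraic over `ℂ(λ)`: there are `d ≥ 1` (the number of cosets of
`Γ ∩ Γ(2)` in `Γ(2)`) and `A_0, …, A_d ∈ ℂ[X]` with `A_d = (X(1−X))^{kd} ≠ 0` and
`Σ_{n ≤ d} A_n(λ(τ)) (f(τ)/θ₃(τ)^{4k})ⁿ = 0` on `ℍ`. (`exists_polynomial_relation_of_invariant`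
for `F = f/Uᵏ` and the level `Γ ∩ Γ(2)`, with the three lemmas above.)
[cite: CalegariDimitrovTang2025, §1 p. 3 ("`f` is then an algebraic function of `λ`")] -/
theorem exists_polynomial_relation_modularForm {Γ : Subgroup SL(2, ℤ)} [Γ.FiniteIndex] (k : ℕ)
    (f : ModularForm (Γ : Subgroup (GL (Fin 2) ℝ)) (2 * k : ℤ)) :
    ∃ (d : ℕ) (A : ℕ → ℂ[X]), 0 < d ∧ A d = (X * (1 - X)) ^ (k * d) ∧
      ∀ τ : ℍ, ∑ n ∈ Finset.range (d + 1),
        (A n).eval (modularLambda τ) * (f τ / theta3 τ ^ (4 * k)) ^ n = 0 := by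
  set F : ℂ → ℂ := fun z ↦ f (ofComplex z) / theta3 z ^ (4 * k) with hF
  have hinv : ∀ γ ∈ Γ ⊓ CongruenceSubgroup.Gamma 2, ∀ z : ℍ, F ((γ • z : ℍ) : ℂ) = F z := by
    intro γ hγ z
    obtain ⟨hγ1, hγ2⟩ := Subgroup.mem_inf.mp hγ
    simpa only [hF, ofComplex_apply] using modularForm_div_smul k f hγ1 hγ2 z
  have hgr : ∀ g : SL(2, ℤ), ∃ B M : ℝ, ∀ z : ℍ, B ≤ z.im →
      ‖F ((g • z : ℍ) : ℂ)‖ ≤ M * Real.exp (π * k * z.im) := fun g ↦ by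
    simpa only [hF, ofComplex_apply] using exists_norm_modularForm_div_smul_le k f g
  obtain ⟨d, A, hd, hAd, hrel⟩ :=
    exists_polynomial_relation_of_invariant (Γ := Γ ⊓ CongruenceSubgroup.Gamma 2) k
      (differentiableOn_modularForm_div k f) hinv hgr
  refine ⟨d, A, hd, hAd, fun τ ↦ ?_⟩
  have := hrel τ τ.im_pos
  simpa only [hF, ofComplex_apply] using this

/-- **The same, with denominators cleared**: `Σ_{n ≤ d} A_n(λ) θ₃^{4k(d−n)} fⁿ = 0` on `ℍ`, with
`A_d = (X(1−X))^{kd}` — a polynomial relation between `f`, `λ` and `θ₃⁴`.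
[cite: CalegariDimitrovTang2025, §1 p. 3] -/
theorem exists_polynomial_relation_modularForm' {Γ : Subgroup SL(2, ℤ)} [Γ.FiniteIndex] (k : ℕ)
    (f : ModularForm (Γ : Subgroup (GL (Fin 2) ℝ)) (2 * k : ℤ)) :
    ∃ (d : ℕ) (A : ℕ → ℂ[X]), 0 < d ∧ A d = (X * (1 - X)) ^ (k * d) ∧
      ∀ τ : ℍ, ∑ n ∈ Finset.range (d + 1),
        (A n).eval (modularLambda τ) * theta3 τ ^ (4 * k * (d - n)) * f τ ^ n = 0 := by
  obtain ⟨d, A, hd, hAd, h⟩ := exists_polynomial_relation_modularForm k f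
  refine ⟨d, A, hd, hAd, fun τ ↦ ?_⟩
  have hθ : theta3 (τ : ℂ) ≠ 0 := theta3_ne_zero τ.im_pos
  have key := congrArg (· * theta3 (τ : ℂ) ^ (4 * k * d)) (h τ)
  simp only [zero_mul, Finset.sum_mul] at key
  rw [← key]
  refine Finset.sum_congr rfl fun n hn ↦ ?_
  have hnd : n ≤ d := Nat.lt_succ_iff.mp (Finset.mem_range.mp hn)
  have hsplit : theta3 (τ : ℂ) ^ (4 * k * d) =
      theta3 (τ : ℂ) ^ (4 * k * n) * theta3 (τ : ℂ) ^ (4 * k * (d - n)) := by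
    rw [← pow_add, ← mul_add, Nat.add_sub_cancel' hnd]
  rw [div_pow, ← pow_mul, hsplit]
  field_simp

/-! ### `M_{2k}(Γ(2))` is finite-dimensional: polynomials in `λ` of degree `≤ 3k` -/

/-- **Modular forms of weight `2k` for `Γ(2)` are `θ₃^{4k} P(λ)/(λ(1−λ))ᵏ`, `deg P ≤ 3k`.**
For `f ∈ M_{2k}(Γ(2))` there is `P ∈ ℂ[X]` of degree `≤ 3k` with
`(f/θ₃^{4k}) · λᵏ(1−λ)ᵏ = P(λ)` on `ℍ` (the Laurent-polynomial theorem of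
`ModularLambdaLaurent.lean` for the weight-zero quotient `f/Uᵏ`, which is `Γ(2)`-invariant with
growth `≤ e^{πk Im z}` at every cusp).
[cite: CalegariDimitrovTang2025, §4.2 (after Definition 22: `Y(2) = Spec ℂ[λ, 1/λ, 1/(1−λ)]`)] -/
theorem exists_polynomial_modularForm_Gamma_two (k : ℕ)
    (f : ModularForm ((CongruenceSubgroup.Gamma 2 : Subgroup SL(2, ℤ)) : Subgroup (GL (Fin 2) ℝ))
      (2 * k : ℤ)) :
    ∃ P : ℂ[X], P.natDegree ≤ 3 * k ∧ ∀ τ : ℍ,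
      f τ / theta3 τ ^ (4 * k) * (modularLambda τ ^ k * (1 - modularLambda τ) ^ k) =
        P.eval (modularLambda τ) := by
  set F : ℂ → ℂ := fun z ↦ f (ofComplex z) / theta3 z ^ (4 * k) with hF
  have hinv : ∀ γ ∈ CongruenceSubgroup.Gamma 2, ∀ z : ℍ, F ((γ • z : ℍ) : ℂ) = F z := by
    intro γ hγ z
    simpa only [hF, ofComplex_apply] using modularForm_div_smul k f hγ hγ z
  have hgr : ∀ g : SL(2, ℤ), ∃ B M : ℝ, ∀ z : ℍ, B ≤ z.im →
      ‖F ((g • z : ℍ) : ℂ)‖ ≤ M * Real.exp (π * k * z.im) := fun g ↦ by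
    simpa only [hF, ofComplex_apply] using exists_norm_modularForm_div_smul_le k f g
  obtain ⟨P, hP, hrel⟩ := exists_polynomial_of_Gamma_two_invariant_of_forall k
    (differentiableOn_modularForm_div k f) hinv hgr
  refine ⟨P, hP, fun τ ↦ ?_⟩
  simpa only [hF, ofComplex_apply] using hrel τ τ.im_pos

/-- **`M_{2k}(Γ(2))` is finite-dimensional, of dimension `≤ 3k + 1`**: `f ↦ P` (the polynomial
of `exists_polynomial_modularForm_Gamma_two`) is an injective linear map into the polynomials of
degree `≤ 3k`. (Mathlib has finite-dimensionality of spaces of modular forms in level one only.)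
[cite: CalegariDimitrovTang2025, §4.2] -/
theorem finiteDimensional_modularForm_Gamma_two (k : ℕ) :
    FiniteDimensional ℂ (ModularForm
      ((CongruenceSubgroup.Gamma 2 : Subgroup SL(2, ℤ)) : Subgroup (GL (Fin 2) ℝ)) (2 * k : ℤ)) ∧
    Module.finrank ℂ (ModularForm
      ((CongruenceSubgroup.Gamma 2 : Subgroup SL(2, ℤ)) : Subgroup (GL (Fin 2) ℝ)) (2 * k : ℤ)) ≤
      3 * k + 1 := by
  classical
  set Γ2 : Subgroup (GL (Fin 2) ℝ) :=
    ((CongruenceSubgroup.Gamma 2 : Subgroup SL(2, ℤ)) : Subgroup (GL (Fin 2) ℝ)) with hΓ2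
  have key := exists_polynomial_modularForm_Gamma_two k
  set Pf : ModularForm Γ2 (2 * k : ℤ) → ℂ[X] := fun f ↦ Classical.choose (key f) with hPf
  have hPf_deg : ∀ f, (Pf f).natDegree ≤ 3 * k := fun f ↦ (Classical.choose_spec (key f)).1
  have hPf_eval : ∀ f (τ : ℍ), f τ / theta3 τ ^ (4 * k) *
      (modularLambda τ ^ k * (1 - modularLambda τ) ^ k) = (Pf f).eval (modularLambda τ) :=
    fun f ↦ (Classical.choose_spec (key f)).2
  -- linearity from uniqueness
  have hadd : ∀ f g, Pf (f + g) = Pf f + Pf g := fun f g ↦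
    polynomial_eq_of_eval_modularLambda_eq fun τ ↦ by
      rw [eval_add, ← hPf_eval, ← hPf_eval, ← hPf_eval, ModularForm.add_apply]
      ring
  have hsmul : ∀ (c : ℂ) f, Pf (c • f) = c • Pf f := fun c f ↦
    polynomial_eq_of_eval_modularLambda_eq fun τ ↦ by
      rw [eval_smul, ← hPf_eval, ← hPf_eval, smul_eq_mul, show (c • f) τ = c * f τ from rfl]
      ring
  let L : ModularForm Γ2 (2 * k : ℤ) →ₗ[ℂ] ℂ[X] :=
    { toFun := Pf, map_add' := hadd, map_smul' := hsmul }
  have hLinj : Function.Injective L := by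
    intro f g hfg
    have h' : Pf f = Pf g := hfg
    refine ModularForm.ext fun τ ↦ ?_
    have e1 := hPf_eval f τ
    rw [h', ← hPf_eval g τ] at e1
    have hm : modularLambda (τ : ℂ) ^ k * (1 - modularLambda τ) ^ k ≠ 0 :=
      mul_ne_zero (pow_ne_zero _ (modularLambda_ne_zero τ.im_pos))
        (pow_ne_zero _ (sub_ne_zero.mpr (modularLambda_ne_one τ.im_pos).symm))
    have hθ : theta3 (τ : ℂ) ^ (4 * k) ≠ 0 := pow_ne_zero _ (theta3_ne_zero τ.im_pos)
    exact (div_left_inj' hθ).mp (mul_right_cancel₀ hm e1)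
  have hrange : ∀ f, L f ∈ Polynomial.degreeLT ℂ (3 * k + 1) := fun f ↦ by
    rw [Polynomial.mem_degreeLT]
    exact Polynomial.degree_le_natDegree.trans_lt (by exact_mod_cast Nat.lt_succ_of_le (hPf_deg f))
  set L' := LinearMap.codRestrict (Polynomial.degreeLT ℂ (3 * k + 1)) L hrange with hL'
  have hL'inj : Function.Injective L' := fun f g h ↦ hLinj (by
    have := congrArg Subtype.val h
    simpa only [hL', LinearMap.codRestrict_apply] using this)
  haveI : FiniteDimensional ℂ (Polynomial.degreeLT ℂ (3 * k + 1)) :=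
    LinearEquiv.finiteDimensional (Polynomial.degreeLTEquiv ℂ (3 * k + 1)).symm
  have hfd : FiniteDimensional ℂ (ModularForm Γ2 (2 * k : ℤ)) :=
    FiniteDimensional.of_injective L' hL'inj
  refine ⟨hfd, ?_⟩
  calc Module.finrank ℂ (ModularForm Γ2 (2 * k : ℤ))
      ≤ Module.finrank ℂ (Polynomial.degreeLT ℂ (3 * k + 1)) :=
        LinearMap.finrank_le_finrank_of_injective hL'inj
    _ = 3 * k + 1 := by
        rw [(Polynomial.degreeLTEquiv ℂ (3 * k + 1)).finrank_eq, Module.finrank_fin_fun]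

end ModularLambda

end Literature.NumberTheory.Automorphic

end
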